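/-
Copyright (c) 2026 the pub-hodgecm-mathlib formalisation cell (harness21).  Prover seat hodgecm-mathlib-LH4-p14 (g4): Track A «(D-RAM) FOUR-FRAME» squad of crux H413, unit U2H (ii-H),
(ρ2b′-X) payer of record (heir) — THE HEAD-OF-ORGANS IN HYPOTHESIS FORM: `hOrgNV`'s clause at one place from TWO organ sockets — the ANISOTROPIC LITERAL (O-Lit brick 2) and the
SIGNED CENSUS of a literal pair (O-Glue ∘ O-Cone ∘ T5 ∘ T5s ∘ O-Hside ∘ O-Sign) — everything else discharged from ★ (payer MAP v1 104f31d9 seams S0, S1, S3-th, S4-frame), 2026-09-04.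
-/
import Summits.HodgeConjecture.HodgeConjecture.Theorems.F0P3cDyRamFixedPointCensusTypeTwoPrelude     -- ★ p857439 (this seat): S0 `natCard_quot_eq_card_residueField`, S1 `eq_of_valued_eq_toPlace_uniformizer_pow`; brings every token of :418
import Literature.NumberTheory.Rogawski1990.TypeTwoRamifiedFrameLiteral                          -- ★ p847566∕… (F0P3a-p03): `exists_isLocalNormPair_coe_eq_of_frame`, `finKappaAt_eq_hilbertSymbol_of_coe_eq_of_frame` (the frame literal t₀, 2-free)
import Literature.NumberTheory.Rogawski1990.FinExplicitTransferFactorTokensScalarAnyPlace         -- ★ p856257: `tokens_anyPlace_of_isLocalGRegular` (depth token m and symmetrised discriminant β EXIST near 1, any residue characteristic)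
import Literature.NumberTheory.Automorphic.UnitaryGroupFormCongrFinSum                          -- ★ `formCongr_one_eq`
import HarnessLib

/-!
# F0 · P3c · line LH4 «(D-RAM) FOUR-FRAME» — unit (ii-H), leaf (ρ2b′-X): THE HEAD-OF-ORGANS IN HYPOTHESIS FORM (`hOrgNV`'s clause at one place from the two organ sockets)
(Rogawski 1990 §4.3, §4.9 Prop. 4.9.1 (b), Lemma 4.9.3; Labesse–Langlands 1979 §2; Kottwitz 1986 §1)

Cell `pub/hodgecm-mathlib`, crux H413 = `stmt-HodgeConjecture-24833` (helper lane, count-neutral); THEOREMS ONLY (no definition, no instance, no notation, no named fact, no `sorry`,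
default heartbeats), typed under the LINE FILE's scopes.  Socket served: the hypothesis of ★ p857404 `…Pointwise.fixedPointCensus_typeTwo_unit0_at_of_signedCensusNV_at` (= the clause
of `hOrgNV`, ★ p857374) at one place `w ∣ v` — hence, by one lambda, the U2H ED. 16 row `stub_U2H_fixedPointCensus_typeTwo_unit0_tE2` once the two sockets below are ★ at `tE = 2`
(heir LEAD T19-02 (R-25) (c2); payer MAP v1 `F0/P3c/LH4/LH4-p14/g4/HEAD-OF-ORGANS-MAP.v1.LH4p14g4.md` 104f31d9).

WHAT IS PROVED: **`hOrgNV_at_of_organs (hLitA) (hCensus) : ‹hOrgNV's clause at (L, w, ϖ, d, t_E)›`**, where the two ORGAN SOCKETS are neighbourhood-local statements in the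
pattern of ★ `DepthZeroKappaTransferTypeOneRamifiedGSide` (`hLit`∕`hSum`):
* `hLitA` — THE ANISOTROPIC LITERAL (O-Lit brick 2, heir F0P3a-p01 (g33); wild twin of ★ `exists_vDeep_oppositeLiteral_frame_charpoly_ram` at `H′ = Φ₃`, its conclusion's
  letters VERBATIM minus the tame-only clauses): near `1`, every `G`-regular type-(2) `γ_H = (g, u)` has a match `t_a` with `κ_v(γ_H, t_a) = −1` whose one-place matrix is
  `P₁·ι(γ₁, u_w)·P₁⁻¹` for a frame `P₁` with `ᵗσ̄P₁·Φ₃·P₁ = diag(d₀, η, d₁)`-block (`dᵢ`, `η` σ-fixed units, the plane `diag(d₀,d₁)` ANISOTROPIC, `η` a NON-NORM), `γ₁ ∈ U(diag d)`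
  integral with the characteristic polynomial of `g_w`;
* `hCensus` — THE SIGNED CENSUS OF A LITERAL PAIR (payer lineage, file `…FixedPointCensusTypeTwoCensus`: O-Glue COUNT (LH4-p07) ∘ O-Cone∕O-W (LH4-p12 ★) ∘ T5a∕b∕c ∘ T5s (LH4-p04 ★
  p857350) ∘ O-Hside (LH4-p09 ★ p857316) ∘ descent (g33 ★ p857432) ∘ O-Sign (LH4-p13)): near `1`, for every `G`-regular type-(2) `γ_H`, every hyperbolic literal `t_h` (one-place
  matrix `ι(g_w, u_w)` ON THE NOSE) and every anisotropic literal `t_a` as above, and every token pair `(m, β)` of :418: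
  `(q_w − 1)·(N t_h − N t_a) = (β, θ)_v·q_w^m·((q_w − 1)·(#Fix_{γ₂}(U₂ ⧸ K₂) + d % 2) − 2·(q_w^S − 1))`, `S = d − d % 2` — `hOrgNV`'s [G-side] with `et := (β,θ)_v`, `mm := m`,
  `NV := #Fix + d % 2` (so [H-side] is `rfl`).
THE HEAD DISCHARGES FROM ★: (S0) `q_v = q_w` (★ Prelude); the TOKENS `(m₀, β₀)` of `γ_H` EXIST near 1 (★ `tokens_anyPlace_of_isLocalGRegular`, any residue characteristic) and are
UNIQUE (`m` by ★ Prelude `eq_of_valued_eq_toPlace_uniformizer_pow`, `β` by injectivity of `ι_w`), so [G] holds with `mm := m₀`, `et := (β₀, θ)_v` and the token clause reduces to them;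
(S3-th) THE HYPERBOLIC LITERAL `t_h` with `ι_w(t_h) = ι(g_w, u_w)` and `κ_v(γ_H, t_h) = (1, θ)_v = 1` (★ frame literal at `A := 1`: `Φ₃`'s own frame, `−det Φ₃ = 1`; 2-free); `s_y := 1`.
`V :=` the token tube ∩ the two sockets' neighbourhoods.

HONEST LABEL: HC_CM is proved only modulo the 7 printed citations (2 remaining named inputs: hLiu418 = stmt-HodgeConjecture-24832, h413 = stmt-HodgeConjecture-24833) until rung 0
closes; this file is a reduction (count-neutral) — `hLitA` and `hCensus` are OPEN organ sockets of the payer's MAP (sub-ledger (R-25): to be delivered at `tE = 2`); nothing in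
them is asserted here.

## References
* [Rogawski1990] J. D. Rogawski, *Automorphic Representations of Unitary Groups in Three Variables*, Ann. of Math. Stud. 123 (1990), §4.3 (4.3.2) p. 43; §4.9 Prop. 4.9.1 (b) p. 55,
  Lemma 4.9.3 p. 56; §14.2 p. 233.
* [LabesseLanglands1979] J.-P. Labesse, R. P. Langlands, *L-indistinguishability for SL(2)*, Canad. J. Math. 31 (1979), §2 p. 8, (2.1).
* [Kottwitz1986BaseChangeUnits] R. E. Kottwitz, *Base change for unit elements of Hecke algebras*, Compositio Math. 60 (1986), §1 pp. 240–241.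
* [Jacobowitz1962] R. Jacobowitz, *Hermitian forms over local fields*, Amer. J. Math. 84 (1962), §7 Thm. 7.1.
-/

set_option autoImplicit false

noncomputable section

namespace Summit.HodgeConjecture.HodgeConjecture.Cruxes.H413.F0P3cDyRamFixedPointCensusTypeTwoOfOrgans

-- THE LINES MODULE'S `open` CONTEXT (tree `Cruxes/H413/Lines/F0_P3c_DyRamFourFrame_U2H_HSide.lean`, after its `namespace`):
open MeasureTheory Measure NumberField IsDedekindDomain Topology Filter
open Literature.NumberTheory.Automorphic Literature.NumberTheory.Automorphic.UnitaryGroup Literature.NumberTheory.Automorphic.IntegralReduction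
open Literature.NumberTheory.Rogawski1990 Literature.NumberTheory.GaloisRepresentations
open Literature.NumberTheory.Automorphic.UnitaryThreeFourFrame
open Summit.HodgeConjecture.HodgeConjecture.Cruxes.H413.F0P3cDyRamFourFrameHSideDefs
open Summit.HodgeConjecture.HodgeConjecture.Cruxes.H413.F0P3cDyRamFourFrameHFamilyDefs
open scoped Matrix MatrixGroups Classical ValuativeRel
open Summit.HodgeConjecture.HodgeConjecture.Cruxes.H413.F0P3cDyRamFourFrameHSideDefsR
open Summit.HodgeConjecture.HodgeConjecture.Cruxes.H413.F0P3cDyRamFourFrameLawDefsR (shiftT shiftR)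
open Literature.NumberTheory.Automorphic.UnitaryLatticeTree Literature.NumberTheory.Automorphic.HermitianLattice
open Literature.NumberTheory.QuadraticForms
open Summit.HodgeConjecture.HodgeConjecture.Cruxes.H413

/-- **THE HEAD-OF-ORGANS IN HYPOTHESIS FORM** — `hOrgNV`'s clause at `(L, w, ϖ, d)` (it does not mention `t_E`) from the anisotropic-literal socket `hLitA` and the signed-census socket `hCensus`
(see the module docstring); the hyperbolic literal, its sign `+1`, the tokens and `q_v = q_w` are discharged from ★ here.
[cite: Rogawski1990, §4.3 (4.3.2) p. 43; §4.9 Prop. 4.9.1 (b) p. 55, Lemma 4.9.3 p. 56; §14.2 p. 233] [cite: LabesseLanglands1979, §2 p. 8] [cite: Kottwitz1986BaseChangeUnits, §1 pp. 240–241]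
[cite: Jacobowitz1962, §7 Thm. 7.1] -/
theorem hOrgNV_at_of_organs (L : Type) [Field L] [NumberField L] [IsCMField L]
    {v : HeightOneSpectrum (𝓞 ↥(maximalRealSubfield L))} (w : UnitaryGroup.PlacesOver L v)
    (hw : IsCMField.complexConj L • w.1 = w.1) (he : v.asIdeal.ramificationIdx' w.1.asIdeal ≠ 1)
    (ϖ : (w.1.adicCompletion L)) (d : ℕ)
    [Fintype (Valued.ResidueField (w.1.adicCompletion L))]
    (hLitA :
      ∃ V ∈ 𝓝 (1 : ((UnitaryGroup.cmDatum L 2 (Matrix.of fun i j : Fin 2 => if i.val + j.val + 1 = 2 then (1 : L) else 0)).Local v × (UnitaryGroup.cmDatum L 1 (Matrix.of fun i j : Fin 1 => if i.val + j.val + 1 = 1 then (1 : L) else 0)).Local v)), ∀ γH ∈ V, IsLocalGRegular L v γH →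
        ¬ (∃ x : (w.1.adicCompletion L), (((((γH).1.val : GL (Fin 2) (UnitaryGroup.LocalRing L v)).val.map (Pi.evalRingHom (fun w' : UnitaryGroup.PlacesOver L v => w'.1.adicCompletion L) w))).charpoly).IsRoot x) →
        ∃ (ta : ((UnitaryGroup.cmDatum L 3 (Matrix.of fun i j : Fin 3 => if i.val + j.val + 1 = 3 then (1 : L) else 0)).Local v)) (P₁ : GL (Fin 3) (w.1.adicCompletion L)) (dg : Fin 2 → (w.1.adicCompletion L)) (η : (w.1.adicCompletion L)) (γ₁ : GL (Fin 2) (w.1.adicCompletion L)),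
          IsLocalNormPair L (Matrix.of fun i j : Fin 3 => if i.val + j.val + 1 = 3 then (1 : L) else 0) v γH ta ∧ finKappaAt L v (Matrix.of fun i j : Fin 3 => if i.val + j.val + 1 = 3 then (1 : L) else 0) γH ta = -1 ∧
          ((localNonsplitEquiv (IsCMField.complexConj L) (Matrix.of fun i j : Fin 3 => if i.val + j.val + 1 = 3 then (1 : L) else 0) (IsCMField.complexConj_ne_one L) w hw ta : ↥(unitaryGroupOfForm (galAdicCompletionMap (L := L) (IsCMField.complexConj L) hw) (placeForm (Matrix.of fun i j : Fin 3 => if i.val + j.val + 1 = 3 then (1 : L) else 0) w.1))) : GL (Fin 3) (w.1.adicCompletion L)) = P₁ * endoGL (γ₁, ((localNonsplitEquiv (IsCMField.complexConj L) (Matrix.of fun i j : Fin 1 => if i.val + j.val + 1 = 1 then (1 : L) else 0) (IsCMField.complexConj_ne_one L) w hw γH.2).val : GL (Fin 1) (w.1.adicCompletion L))) * P₁⁻¹ ∧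
          formCongr (galAdicCompletionMap (L := L) (IsCMField.complexConj L) hw) P₁ (placeForm (Matrix.of fun i j : Fin 3 => if i.val + j.val + 1 = 3 then (1 : L) else 0) w.1) = (!![(Matrix.diagonal dg) 0 0, 0, (Matrix.diagonal dg) 0 1; 0, η, 0; (Matrix.diagonal dg) 1 0, 0, (Matrix.diagonal dg) 1 1] : Matrix (Fin 3) (Fin 3) (w.1.adicCompletion L)) ∧
          (∀ i, Valued.v (dg i) = 1) ∧
          (∀ i, (galAdicCompletionMap (L := L) (IsCMField.complexConj L) hw) (dg i) = dg i) ∧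
          (∀ c : (w.1.adicCompletion L), Valued.v c ≤ 1 → Valued.v (dg 0 + dg 1 * ((galAdicCompletionMap (L := L) (IsCMField.complexConj L) hw) c * c)) = 1) ∧
          (∀ c : (w.1.adicCompletion L), Valued.v c ≤ 1 → Valued.v (dg 0 * ((galAdicCompletionMap (L := L) (IsCMField.complexConj L) hw) c * c) + dg 1) = 1) ∧
          (galAdicCompletionMap (L := L) (IsCMField.complexConj L) hw) η = η ∧
          Valued.v η = 1 ∧
          (¬ ∃ t : (w.1.adicCompletion L), t * (galAdicCompletionMap (L := L) (IsCMField.complexConj L) hw) t = η) ∧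
          γ₁ ∈ unitaryGroupOfForm (galAdicCompletionMap (L := L) (IsCMField.complexConj L) hw) (Matrix.diagonal dg) ∧
          (∀ i j, Valued.v ((γ₁ : Matrix (Fin 2) (Fin 2) (w.1.adicCompletion L)) i j) ≤ 1) ∧
          (γ₁ : Matrix (Fin 2) (Fin 2) (w.1.adicCompletion L)).charpoly = (((γH.1.val : GL (Fin 2) (UnitaryGroup.LocalRing L v)).val.map (Pi.evalRingHom (fun w' : UnitaryGroup.PlacesOver L v => w'.1.adicCompletion L) w))).charpoly)
    (hCensus :
      ∃ V ∈ 𝓝 (1 : ((UnitaryGroup.cmDatum L 2 (Matrix.of fun i j : Fin 2 => if i.val + j.val + 1 = 2 then (1 : L) else 0)).Local v × (UnitaryGroup.cmDatum L 1 (Matrix.of fun i j : Fin 1 => if i.val + j.val + 1 = 1 then (1 : L) else 0)).Local v)), ∀ γH ∈ V, IsLocalGRegular L v γH →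
        ¬ (∃ x : (w.1.adicCompletion L), (((((γH).1.val : GL (Fin 2) (UnitaryGroup.LocalRing L v)).val.map (Pi.evalRingHom (fun w' : UnitaryGroup.PlacesOver L v => w'.1.adicCompletion L) w))).charpoly).IsRoot x) →
        ∀ (th ta : ((UnitaryGroup.cmDatum L 3 (Matrix.of fun i j : Fin 3 => if i.val + j.val + 1 = 3 then (1 : L) else 0)).Local v)) (P₁ : GL (Fin 3) (w.1.adicCompletion L)) (dg : Fin 2 → (w.1.adicCompletion L)) (η : (w.1.adicCompletion L)) (γ₁ : GL (Fin 2) (w.1.adicCompletion L)),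
          ((localNonsplitEquiv (IsCMField.complexConj L) (Matrix.of fun i j : Fin 3 => if i.val + j.val + 1 = 3 then (1 : L) else 0) (IsCMField.complexConj_ne_one L) w hw th : ↥(unitaryGroupOfForm (galAdicCompletionMap (L := L) (IsCMField.complexConj L) hw) (placeForm (Matrix.of fun i j : Fin 3 => if i.val + j.val + 1 = 3 then (1 : L) else 0) w.1))) : GL (Fin 3) (w.1.adicCompletion L)) = endoGL (((localNonsplitEquiv (IsCMField.complexConj L) (Matrix.of fun i j : Fin 2 => if i.val + j.val + 1 = 2 then (1 : L) else 0) (IsCMField.complexConj_ne_one L) w hw γH.1 : ↥(unitaryGroupOfForm (galAdicCompletionMap (L := L) (IsCMField.complexConj L) hw) (placeForm (Matrix.of fun i j : Fin 2 => if i.val + j.val + 1 = 2 then (1 : L) else 0) w.1))) : GL (Fin 2) (w.1.adicCompletion L)), ((localNonsplitEquiv (IsCMField.complexConj L) (Matrix.of fun i j : Fin 1 => if i.val + j.val + 1 = 1 then (1 : L) else 0) (IsCMField.complexConj_ne_one L) w hw γH.2).val : GL (Fin 1) (w.1.adicCompletion L))) →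
          ((localNonsplitEquiv (IsCMField.complexConj L) (Matrix.of fun i j : Fin 3 => if i.val + j.val + 1 = 3 then (1 : L) else 0) (IsCMField.complexConj_ne_one L) w hw ta : ↥(unitaryGroupOfForm (galAdicCompletionMap (L := L) (IsCMField.complexConj L) hw) (placeForm (Matrix.of fun i j : Fin 3 => if i.val + j.val + 1 = 3 then (1 : L) else 0) w.1))) : GL (Fin 3) (w.1.adicCompletion L)) = P₁ * endoGL (γ₁, ((localNonsplitEquiv (IsCMField.complexConj L) (Matrix.of fun i j : Fin 1 => if i.val + j.val + 1 = 1 then (1 : L) else 0) (IsCMField.complexConj_ne_one L) w hw γH.2).val : GL (Fin 1) (w.1.adicCompletion L))) * P₁⁻¹ →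
          formCongr (galAdicCompletionMap (L := L) (IsCMField.complexConj L) hw) P₁ (placeForm (Matrix.of fun i j : Fin 3 => if i.val + j.val + 1 = 3 then (1 : L) else 0) w.1) = (!![(Matrix.diagonal dg) 0 0, 0, (Matrix.diagonal dg) 0 1; 0, η, 0; (Matrix.diagonal dg) 1 0, 0, (Matrix.diagonal dg) 1 1] : Matrix (Fin 3) (Fin 3) (w.1.adicCompletion L)) →
          (∀ i, Valued.v (dg i) = 1) →
          (∀ i, (galAdicCompletionMap (L := L) (IsCMField.complexConj L) hw) (dg i) = dg i) →
          (∀ c : (w.1.adicCompletion L), Valued.v c ≤ 1 → Valued.v (dg 0 + dg 1 * ((galAdicCompletionMap (L := L) (IsCMField.complexConj L) hw) c * c)) = 1) →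
          (∀ c : (w.1.adicCompletion L), Valued.v c ≤ 1 → Valued.v (dg 0 * ((galAdicCompletionMap (L := L) (IsCMField.complexConj L) hw) c * c) + dg 1) = 1) →
          (galAdicCompletionMap (L := L) (IsCMField.complexConj L) hw) η = η →
          Valued.v η = 1 →
          (¬ ∃ t : (w.1.adicCompletion L), t * (galAdicCompletionMap (L := L) (IsCMField.complexConj L) hw) t = η) →
          γ₁ ∈ unitaryGroupOfForm (galAdicCompletionMap (L := L) (IsCMField.complexConj L) hw) (Matrix.diagonal dg) →
          (∀ i j, Valued.v ((γ₁ : Matrix (Fin 2) (Fin 2) (w.1.adicCompletion L)) i j) ≤ 1) →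
          (γ₁ : Matrix (Fin 2) (Fin 2) (w.1.adicCompletion L)).charpoly = (((γH.1.val : GL (Fin 2) (UnitaryGroup.LocalRing L v)).val.map (Pi.evalRingHom (fun w' : UnitaryGroup.PlacesOver L v => w'.1.adicCompletion L) w))).charpoly →
          ∀ (m : ℕ) (β : (v.adicCompletion ↥(maximalRealSubfield L))ˣ), Valued.v (((finCharpolyTwo L v γH).eval (finGammaTwo L v γH)) w) = Valued.v ((toPlace v w (HeckeCharacter.uniformizer ↥(maximalRealSubfield L) v : v.adicCompletion ↥(maximalRealSubfield L))) ^ m) →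
            toPlace v w (β : (v.adicCompletion ↥(maximalRealSubfield L))) = -(((finCharpolyTwo L v γH).eval (finGammaTwo L v γH)) w * (finGammaTwo L v γH w ^ 2 + ((γH.1.val.val : Matrix (Fin 2) (Fin 2) (UnitaryGroup.LocalRing L v)).map (Pi.evalRingHom (fun w' : UnitaryGroup.PlacesOver L v => w'.1.adicCompletion L) w)).det)) / (2 * finGammaTwo L v γH w ^ 2 * ((γH.1.val.val : Matrix (Fin 2) (Fin 2) (UnitaryGroup.LocalRing L v)).map (Pi.evalRingHom (fun w' : UnitaryGroup.PlacesOver L v => w'.1.adicCompletion L) w)).det) →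
            (((Fintype.card (Valued.ResidueField (w.1.adicCompletion L))) : ℤ) - 1) * ((({M : Submodule (Valued.integer (w.1.adicCompletion L)) (Fin 3 → (w.1.adicCompletion L)) | IsVertexLattice (galAdicCompletionMap (L := L) (IsCMField.complexConj L) hw) ϖ ((StdForm.antidiagonal 3).over (w.1.adicCompletion L)) 0 M ∧ mapGL ((localNonsplitEquiv (IsCMField.complexConj L) (Matrix.of fun i j : Fin 3 => if i.val + j.val + 1 = 3 then (1 : L) else 0) (IsCMField.complexConj_ne_one L) w hw th : ↥(unitaryGroupOfForm (galAdicCompletionMap (L := L) (IsCMField.complexConj L) hw) (placeForm (Matrix.of fun i j : Fin 3 => if i.val + j.val + 1 = 3 then (1 : L) else 0) w.1))) : GL (Fin 3) (w.1.adicCompletion L)) M = M}.ncard : ℕ) : ℤ) - (({M : Submodule (Valued.integer (w.1.adicCompletion L)) (Fin 3 → (w.1.adicCompletion L)) | IsVertexLattice (galAdicCompletionMap (L := L) (IsCMField.complexConj L) hw) ϖ ((StdForm.antidiagonal 3).over (w.1.adicCompletion L)) 0 M ∧ mapGL ((localNonsplitEquiv (IsCMField.complexConj L) (Matrix.of fun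 i j : Fin 3 => if i.val + j.val + 1 = 3 then (1 : L) else 0) (IsCMField.complexConj_ne_one L) w hw ta : ↥(unitaryGroupOfForm (galAdicCompletionMap (L := L) (IsCMField.complexConj L) hw) (placeForm (Matrix.of fun i j : Fin 3 => if i.val + j.val + 1 = 3 then (1 : L) else 0) w.1))) : GL (Fin 3) (w.1.adicCompletion L)) M = M}.ncard : ℕ) : ℤ)) = (Literature.NumberTheory.QuadraticForms.hilbertSymbol (v.adicCompletion ↥(maximalRealSubfield L)) (β : (v.adicCompletion ↥(maximalRealSubfield L))) (algebraMap ↥(maximalRealSubfield L) _ ((cmQuadraticGenerator L : 𝓞 ↥(maximalRealSubfield L)) : ↥(maximalRealSubfield L))) : ℤ) * ((Fintype.card (Valued.ResidueField (w.1.adicCompletion L))) : ℤ) ^ m * ((((Fintype.card (Valued.ResidueField (w.1.adicCompletion L))) : ℤ) - 1) * (((Nat.card (MulAction.fixedBy (((UnitaryGroup.cmDatum L 2 (Matrix.of fun i j : Fin 2 => if i.val + j.val + 1 = 2 then (1 : L) else 0)).Local v) ⧸ cmLocalIntegralLevel L 2 (Matrix.of fun i j : Fin 2 => if i.val + j.val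 + 1 = 2 then (1 : L) else 0) v) γH.1)) + d % 2 : ℕ) : ℤ) - 2 * (((Fintype.card (Valued.ResidueField (w.1.adicCompletion L))) : ℤ) ^ (d - d % 2) - 1))) :
    (Nat.card (𝓞 ↥(maximalRealSubfield L) ⧸ v.asIdeal)) = (Fintype.card (Valued.ResidueField (w.1.adicCompletion L))) ∧
    ∃ V ∈ 𝓝 (1 : ((UnitaryGroup.cmDatum L 2 (Matrix.of fun i j : Fin 2 => if i.val + j.val + 1 = 2 then (1 : L) else 0)).Local v × (UnitaryGroup.cmDatum L 1 (Matrix.of fun i j : Fin 1 => if i.val + j.val + 1 = 1 then (1 : L) else 0)).Local v)), ∀ γH ∈ V, IsLocalGRegular L v γH →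
    ¬ (∃ x : (w.1.adicCompletion L), (((((γH).1.val : GL (Fin 2) (UnitaryGroup.LocalRing L v)).val.map (Pi.evalRingHom (fun w' : UnitaryGroup.PlacesOver L v => w'.1.adicCompletion L) w))).charpoly).IsRoot x) →
    ∃ (th ta : ((UnitaryGroup.cmDatum L 3 (Matrix.of fun i j : Fin 3 => if i.val + j.val + 1 = 3 then (1 : L) else 0)).Local v)) (sy et : ℤ) (mm NV : ℕ),
      IsLocalNormPair L (Matrix.of fun i j : Fin 3 => if i.val + j.val + 1 = 3 then (1 : L) else 0) v γH th ∧ IsLocalNormPair L (Matrix.of fun i j : Fin 3 => if i.val + j.val + 1 = 3 then (1 : L) else 0) v γH ta ∧ finKappaAt L v (Matrix.of fun i j : Fin 3 => if i.val + j.val + 1 = 3 then (1 : L) else 0) γH th = sy ∧ finKappaAt L v (Matrix.of fun i j : Fin 3 => if i.val + j.val + 1 = 3 then (1 : L) else 0) γH ta = -sy ∧ (sy = 1 ∨ sy = -1) ∧ (et = 1 ∨ et = -1) ∧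
      (((Fintype.card (Valued.ResidueField (w.1.adicCompletion L))) : ℤ) - 1) * ((({M : Submodule (Valued.integer (w.1.adicCompletion L)) (Fin 3 → (w.1.adicCompletion L)) | IsVertexLattice (galAdicCompletionMap (L := L) (IsCMField.complexConj L) hw) ϖ ((StdForm.antidiagonal 3).over (w.1.adicCompletion L)) 0 M ∧ mapGL ((localNonsplitEquiv (IsCMField.complexConj L) (Matrix.of fun i j : Fin 3 => if i.val + j.val + 1 = 3 then (1 : L) else 0) (IsCMField.complexConj_ne_one L) w hw th : ↥(unitaryGroupOfForm (galAdicCompletionMap (L := L) (IsCMField.complexConj L) hw) (placeForm (Matrix.of fun i j : Fin 3 => if i.val + j.val + 1 = 3 then (1 : L) else 0) w.1))) : GL (Fin 3) (w.1.adicCompletion L)) M = M}.ncard : ℕ) : ℤ) - (({M : Submodule (Valued.integer (w.1.adicCompletion L)) (Fin 3 → (w.1.adicCompletion L)) | IsVertexLattice (galAdicCompletionMap (L := L) (IsCMField.complexConj L) hw) ϖ ((StdForm.antidiagonal 3).over (w.1.adicCompletion L)) 0 M ∧ mapGL ((localNonsplitEquiv (IsCMField.complexConj L) (Matrix.of fun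 i j : Fin 3 => if i.val + j.val + 1 = 3 then (1 : L) else 0) (IsCMField.complexConj_ne_one L) w hw ta : ↥(unitaryGroupOfForm (galAdicCompletionMap (L := L) (IsCMField.complexConj L) hw) (placeForm (Matrix.of fun i j : Fin 3 => if i.val + j.val + 1 = 3 then (1 : L) else 0) w.1))) : GL (Fin 3) (w.1.adicCompletion L)) M = M}.ncard : ℕ) : ℤ)) = et * ((Fintype.card (Valued.ResidueField (w.1.adicCompletion L))) : ℤ) ^ mm * ((((Fintype.card (Valued.ResidueField (w.1.adicCompletion L))) : ℤ) - 1) * (NV : ℤ) - 2 * (((Fintype.card (Valued.ResidueField (w.1.adicCompletion L))) : ℤ) ^ (d - d % 2) - 1)) ∧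
      (Nat.card (MulAction.fixedBy (((UnitaryGroup.cmDatum L 2 (Matrix.of fun i j : Fin 2 => if i.val + j.val + 1 = 2 then (1 : L) else 0)).Local v) ⧸ cmLocalIntegralLevel L 2 (Matrix.of fun i j : Fin 2 => if i.val + j.val + 1 = 2 then (1 : L) else 0) v) γH.1)) + d % 2 = NV ∧
      (∀ (m : ℕ) (β : (v.adicCompletion ↥(maximalRealSubfield L))ˣ), Valued.v (((finCharpolyTwo L v γH).eval (finGammaTwo L v γH)) w) = Valued.v ((toPlace v w (HeckeCharacter.uniformizer ↥(maximalRealSubfield L) v : v.adicCompletion ↥(maximalRealSubfield L))) ^ m) →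
        toPlace v w (β : v.adicCompletion ↥(maximalRealSubfield L)) = -(((finCharpolyTwo L v γH).eval (finGammaTwo L v γH)) w * (finGammaTwo L v γH w ^ 2 + ((γH.1.val.val : Matrix (Fin 2) (Fin 2) (UnitaryGroup.LocalRing L v)).map (Pi.evalRingHom (fun w' : UnitaryGroup.PlacesOver L v => w'.1.adicCompletion L) w)).det)) / (2 * finGammaTwo L v γH w ^ 2 * ((γH.1.val.val : Matrix (Fin 2) (Fin 2) (UnitaryGroup.LocalRing L v)).map (Pi.evalRingHom (fun w' : UnitaryGroup.PlacesOver L v => w'.1.adicCompletion L) w)).det) →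
        m = mm ∧ (Literature.NumberTheory.QuadraticForms.hilbertSymbol (v.adicCompletion ↥(maximalRealSubfield L)) (β : v.adicCompletion ↥(maximalRealSubfield L)) (algebraMap ↥(maximalRealSubfield L) _ ((cmQuadraticGenerator L : 𝓞 ↥(maximalRealSubfield L)) : ↥(maximalRealSubfield L))) : ℂ) * (sy : ℂ) = (et : ℂ)) := by
  classical
  refine ⟨F0P3cDyRamFixedPointCensusTypeTwoPrelude.natCard_quot_eq_card_residueField L w hw he, ?_⟩
  -- the three neighbourhoods: tokens (★), anisotropic literal (socket), census (socket)
  obtain ⟨Vt, hVt, htok⟩ := tokens_anyPlace_of_isLocalGRegular L v w hw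
  obtain ⟨VA, hVA, hA⟩ := hLitA
  obtain ⟨VC, hVC, hC⟩ := hCensus
  refine ⟨Vt ∩ (VA ∩ VC), Filter.inter_mem hVt (Filter.inter_mem hVA hVC), fun γH hγ hreg hirr => ?_⟩
  obtain ⟨hγt, hγA, hγC⟩ := hγ
  -- THE TOKENS of `γ_H` (exist near 1 by ★; unique by ★ Prelude ∕ injectivity of `ι_w`)
  obtain ⟨⟨m₀, hm₀⟩, β₀, hβ₀⟩ := htok γH hγt hreg
  -- THE HYPERBOLIC LITERAL `t_h` (★ frame literal in `Φ₃`'s own frame `A := 1`; `κ = (1, θ)_v = 1`)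
  have hu : IsUnit ((finCharpolyTwo L v γH).eval (finGammaTwo L v γH)) := isUnit_eval_finCharpolyTwo_of_isLocalGRegular L v γH hreg
  have hH'w : IsUnit (placeForm (Matrix.of fun i j : Fin 3 => if i.val + j.val + 1 = 3 then (1 : L) else 0) w.1) := isUnit_placeForm_antidiagOne (E := L) 3 w.1
  have hdet : (placeForm (Matrix.of fun i j : Fin 3 => if i.val + j.val + 1 = 3 then (1 : L) else 0) w.1).det = -1 := by
    rw [placeForm_antidiagOne, F0P3cDyRamFixedPointCensusTypeTwoPrelude.antidiagonal_three_over_eq_block_antidiagonal_two, Matrix.det_fin_three]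
    simp [StdForm.over, StdForm.antidiagonal_J_apply, Fin.rev]
  have hframe : placeForm (Matrix.of fun i j : Fin 3 => if i.val + j.val + 1 = 3 then (1 : L) else 0) w.1 = (-(placeForm (Matrix.of fun i j : Fin 3 => if i.val + j.val + 1 = 3 then (1 : L) else 0) w.1).det) •
      formCongr (galAdicCompletionMap (L := L) (IsCMField.complexConj L) hw) (1 : GL (Fin 3) (w.1.adicCompletion L)) ((StdForm.antidiagonal 3).over (w.1.adicCompletion L)) := by
    rw [formCongr_one_eq, hdet, neg_neg, one_smul, placeForm_antidiagOne]
  have hyl : toPlace v w (1 : (v.adicCompletion ↥(maximalRealSubfield L))) = -(placeForm (Matrix.of fun i j : Fin 3 => if i.val + j.val + 1 = 3 then (1 : L) else 0) w.1).det := by rw [map_one, hdet, neg_neg]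
  obtain ⟨th, hth, hmat⟩ := exists_isLocalNormPair_coe_eq_of_frame L (Matrix.of fun i j : Fin 3 => if i.val + j.val + 1 = 3 then (1 : L) else 0) w hw hH'w 1 hframe γH
  have hκh : finKappaAt L v (Matrix.of fun i j : Fin 3 => if i.val + j.val + 1 = 3 then (1 : L) else 0) γH th = 1 := by
    rw [finKappaAt_eq_hilbertSymbol_of_coe_eq_of_frame L (Matrix.of fun i j : Fin 3 => if i.val + j.val + 1 = 3 then (1 : L) else 0) w hw hH'w 1 hframe 1 hyl γH hu hth hmat, hilbertSymbol_one_left]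
  rw [inv_one, one_mul, mul_one] at hmat
  -- THE ANISOTROPIC LITERAL `t_a` (socket `hLitA`)
  obtain ⟨ta, P₁, dg, η, γ₁, hta, hκa, hA1, hA2, hA3, hA4, hA5, hA6, hA7, hA8, hA9, hA10, hA11, hA12⟩ := hA γH hγA hreg hirr
  -- THE SIGNED CENSUS at the tokens `(m₀, β₀)` (socket `hCensus`)
  have hG := hC γH hγC hreg hirr th ta P₁ dg η γ₁ hmat hA1 hA2 hA3 hA4 hA5 hA6 hA7 hA8 hA9 hA10 hA11 hA12 m₀ β₀ hm₀ hβ₀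
  refine ⟨th, ta, 1, Literature.NumberTheory.QuadraticForms.hilbertSymbol (v.adicCompletion ↥(maximalRealSubfield L)) (β₀ : (v.adicCompletion ↥(maximalRealSubfield L))) (algebraMap ↥(maximalRealSubfield L) _ ((cmQuadraticGenerator L : 𝓞 ↥(maximalRealSubfield L)) : ↥(maximalRealSubfield L))), m₀, (Nat.card (MulAction.fixedBy (((UnitaryGroup.cmDatum L 2 (Matrix.of fun i j : Fin 2 => if i.val + j.val + 1 = 2 then (1 : L) else 0)).Local v) ⧸ cmLocalIntegralLevel L 2 (Matrix.of fun i j : Fin 2 => if i.val + j.val + 1 = 2 then (1 : L) else 0) v) γH.1)) + d % 2, hth, hta, hκh, hκa, Or.inl rfl, hilbertSymbol_eq_one_or_eq_neg_one _ _, hG, rfl, fun m β hm hβ => ⟨?_, ?_⟩⟩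
  · exact F0P3cDyRamFixedPointCensusTypeTwoPrelude.eq_of_valued_eq_toPlace_uniformizer_pow L w hw he hm hm₀
  · have hββ : (β : (v.adicCompletion ↥(maximalRealSubfield L))) = (β₀ : (v.adicCompletion ↥(maximalRealSubfield L))) := (toPlace v w).injective (hβ.trans hβ₀.symm)
    rw [hββ, Int.cast_one, mul_one]

/-! ## ED. 2 (append-only): the sockets RE-LETTERED for residue characteristic 2

The two RESIDUAL-ANISOTROPY clauses of socket (A) in `hOrgNV_at_of_organs` above (`∀ c, |c| ≤ 1 → |d₀ + d₁·σc·c| = 1` and its twin, copied from the TAME ★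
`exists_vDeep_oppositeLiteral_frame_charpoly_ram`) are UNSATISFIABLE at a dyadic place (every residue is a square in characteristic 2, so `d₀ + d₁·σc·c ∈ 𝔭_w` for some unit
`c`): REF5 R5-174, LH-ref2 #43, REF1 R1-645 ∕ BOX #220 (2).  `hOrgNV_at_of_organs` stays true and OFF-SPINE.  The head below is the SAME head with EXACTLY those two conjuncts of
socket (A) and the SAME two antecedents of socket (C) STRUCK (nothing else moves; anisotropy of the plane `diag(d₀, d₁)` is recovered by the census file from the frame equation
`ᵗσ̄P₁·Φ₃·P₁ = block(diag d, η)` and `η ∉ N(L_wˣ)`: `−d₀d₁ ≡ η` modulo norms).  Non-vacuity (heir LEAD T19-06 (R-26)): socket (A′) — payer = heir F0P3a-p01 (g33)'s O-Lit brick 2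
(δ) `exists_anisotropicLiteral_wild_of_partner`; socket (C′) — payer = the census file; model-reader certificate LH4-r01 (g5) 2026-09-04T05:23:27Z (D4u∕D5u∕T4a cells). -/

/-- **THE HEAD-OF-ORGANS IN HYPOTHESIS FORM, DYADIC LETTERS** — as `hOrgNV_at_of_organs` with the two residual-anisotropy clauses of the anisotropic-literal socket struck
(see the section docstring); the hyperbolic literal, its sign `+1`, the tokens and `q_v = q_w` are discharged from ★ exactly as above.
[cite: Rogawski1990, §4.3 (4.3.2) p. 43; §4.9 Prop. 4.9.1 (b) p. 55, Lemma 4.9.3 p. 56; §14.2 p. 233] [cite: LabesseLanglands1979, §2 p. 8] [cite: Kottwitz1986BaseChangeUnits, §1 pp. 240–241]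
[cite: Jacobowitz1962, §7 Thm. 7.1] -/
theorem hOrgNV_at_of_literal_and_census (L : Type) [Field L] [NumberField L] [IsCMField L]
    {v : HeightOneSpectrum (𝓞 ↥(maximalRealSubfield L))} (w : UnitaryGroup.PlacesOver L v)
    (hw : IsCMField.complexConj L • w.1 = w.1) (he : v.asIdeal.ramificationIdx' w.1.asIdeal ≠ 1)
    (ϖ : (w.1.adicCompletion L)) (d : ℕ)
    [Fintype (Valued.ResidueField (w.1.adicCompletion L))]
    (hLitA :
      ∃ V ∈ 𝓝 (1 : ((UnitaryGroup.cmDatum L 2 (Matrix.of fun i j : Fin 2 => if i.val + j.val + 1 = 2 then (1 : L) else 0)).Local v × (UnitaryGroup.cmDatum L 1 (Matrix.of fun i j : Fin 1 => if i.val + j.val + 1 = 1 then (1 : L) else 0)).Local v)), ∀ γH ∈ V, IsLocalGRegular L v γH →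
        ¬ (∃ x : (w.1.adicCompletion L), (((((γH).1.val : GL (Fin 2) (UnitaryGroup.LocalRing L v)).val.map (Pi.evalRingHom (fun w' : UnitaryGroup.PlacesOver L v => w'.1.adicCompletion L) w))).charpoly).IsRoot x) →
        ∃ (ta : ((UnitaryGroup.cmDatum L 3 (Matrix.of fun i j : Fin 3 => if i.val + j.val + 1 = 3 then (1 : L) else 0)).Local v)) (P₁ : GL (Fin 3) (w.1.adicCompletion L)) (dg : Fin 2 → (w.1.adicCompletion L)) (η : (w.1.adicCompletion L)) (γ₁ : GL (Fin 2) (w.1.adicCompletion L)),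
          IsLocalNormPair L (Matrix.of fun i j : Fin 3 => if i.val + j.val + 1 = 3 then (1 : L) else 0) v γH ta ∧ finKappaAt L v (Matrix.of fun i j : Fin 3 => if i.val + j.val + 1 = 3 then (1 : L) else 0) γH ta = -1 ∧
          ((localNonsplitEquiv (IsCMField.complexConj L) (Matrix.of fun i j : Fin 3 => if i.val + j.val + 1 = 3 then (1 : L) else 0) (IsCMField.complexConj_ne_one L) w hw ta : ↥(unitaryGroupOfForm (galAdicCompletionMap (L := L) (IsCMField.complexConj L) hw) (placeForm (Matrix.of fun i j : Fin 3 => if i.val + j.val + 1 = 3 then (1 : L) else 0) w.1))) : GL (Fin 3) (w.1.adicCompletion L)) = P₁ * endoGL (γ₁, ((localNonsplitEquiv (IsCMField.complexConj L) (Matrix.of fun i j : Fin 1 => if i.val + j.val + 1 = 1 then (1 : L) else 0) (IsCMField.complexConj_ne_one L) w hw γH.2).val : GL (Fin 1) (w.1.adicCompletion L))) * P₁⁻¹ ∧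
          formCongr (galAdicCompletionMap (L := L) (IsCMField.complexConj L) hw) P₁ (placeForm (Matrix.of fun i j : Fin 3 => if i.val + j.val + 1 = 3 then (1 : L) else 0) w.1) = (!![(Matrix.diagonal dg) 0 0, 0, (Matrix.diagonal dg) 0 1; 0, η, 0; (Matrix.diagonal dg) 1 0, 0, (Matrix.diagonal dg) 1 1] : Matrix (Fin 3) (Fin 3) (w.1.adicCompletion L)) ∧
          (∀ i, Valued.v (dg i) = 1) ∧
          (∀ i, (galAdicCompletionMap (L := L) (IsCMField.complexConj L) hw) (dg i) = dg i) ∧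
          (galAdicCompletionMap (L := L) (IsCMField.complexConj L) hw) η = η ∧
          Valued.v η = 1 ∧
          (¬ ∃ t : (w.1.adicCompletion L), t * (galAdicCompletionMap (L := L) (IsCMField.complexConj L) hw) t = η) ∧
          γ₁ ∈ unitaryGroupOfForm (galAdicCompletionMap (L := L) (IsCMField.complexConj L) hw) (Matrix.diagonal dg) ∧
          (∀ i j, Valued.v ((γ₁ : Matrix (Fin 2) (Fin 2) (w.1.adicCompletion L)) i j) ≤ 1) ∧
          (γ₁ : Matrix (Fin 2) (Fin 2) (w.1.adicCompletion L)).charpoly = (((γH.1.val : GL (Fin 2) (UnitaryGroup.LocalRing L v)).val.map (Pi.evalRingHom (fun w' : UnitaryGroup.PlacesOver L v => w'.1.adicCompletion L) w))).charpoly)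
    (hCensus :
      ∃ V ∈ 𝓝 (1 : ((UnitaryGroup.cmDatum L 2 (Matrix.of fun i j : Fin 2 => if i.val + j.val + 1 = 2 then (1 : L) else 0)).Local v × (UnitaryGroup.cmDatum L 1 (Matrix.of fun i j : Fin 1 => if i.val + j.val + 1 = 1 then (1 : L) else 0)).Local v)), ∀ γH ∈ V, IsLocalGRegular L v γH →
        ¬ (∃ x : (w.1.adicCompletion L), (((((γH).1.val : GL (Fin 2) (UnitaryGroup.LocalRing L v)).val.map (Pi.evalRingHom (fun w' : UnitaryGroup.PlacesOver L v => w'.1.adicCompletion L) w))).charpoly).IsRoot x) →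
        ∀ (th ta : ((UnitaryGroup.cmDatum L 3 (Matrix.of fun i j : Fin 3 => if i.val + j.val + 1 = 3 then (1 : L) else 0)).Local v)) (P₁ : GL (Fin 3) (w.1.adicCompletion L)) (dg : Fin 2 → (w.1.adicCompletion L)) (η : (w.1.adicCompletion L)) (γ₁ : GL (Fin 2) (w.1.adicCompletion L)),
          ((localNonsplitEquiv (IsCMField.complexConj L) (Matrix.of fun i j : Fin 3 => if i.val + j.val + 1 = 3 then (1 : L) else 0) (IsCMField.complexConj_ne_one L) w hw th : ↥(unitaryGroupOfForm (galAdicCompletionMap (L := L) (IsCMField.complexConj L) hw) (placeForm (Matrix.of fun i j : Fin 3 => if i.val + j.val + 1 = 3 then (1 : L) else 0) w.1))) : GL (Fin 3) (w.1.adicCompletion L)) = endoGL (((localNonsplitEquiv (IsCMField.complexConj L) (Matrix.of fun i j : Fin 2 => if i.val + j.val + 1 = 2 then (1 : L) else 0) (IsCMField.complexConj_ne_one L) w hw γH.1 : ↥(unitaryGroupOfForm (galAdicCompletionMap (L := L) (IsCMField.complexConj L) hw) (placeForm (Matrix.of fun i j : Fin 2 => if i.val + j.val + 1 = 2 then (1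 : L) else 0) w.1))) : GL (Fin 2) (w.1.adicCompletion L)), ((localNonsplitEquiv (IsCMField.complexConj L) (Matrix.of fun i j : Fin 1 => if i.val + j.val + 1 = 1 then (1 : L) else 0) (IsCMField.complexConj_ne_one L) w hw γH.2).val : GL (Fin 1) (w.1.adicCompletion L))) →
          ((localNonsplitEquiv (IsCMField.complexConj L) (Matrix.of fun i j : Fin 3 => if i.val + j.val + 1 = 3 then (1 : L) else 0) (IsCMField.complexConj_ne_one L) w hw ta : ↥(unitaryGroupOfForm (galAdicCompletionMap (L := L) (IsCMField.complexConj L) hw) (placeForm (Matrix.of fun i j : Fin 3 => if i.val + j.val + 1 = 3 then (1 : L) else 0) w.1))) : GL (Fin 3) (w.1.adicCompletion L)) = P₁ * endoGL (γ₁, ((localNonsplitEquiv (IsCMField.complexConj L) (Matrix.of fun i j : Fin 1 => if i.val + j.val + 1 = 1 then (1 : L) else 0) (IsCMField.complexConj_ne_one L) w hw γH.2).val : GL (Fin 1) (w.1.adicCompletion L))) * P₁⁻¹ →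
          formCongr (galAdicCompletionMap (L := L) (IsCMField.complexConj L) hw) P₁ (placeForm (Matrix.of fun i j : Fin 3 => if i.val + j.val + 1 = 3 then (1 : L) else 0) w.1) = (!![(Matrix.diagonal dg) 0 0, 0, (Matrix.diagonal dg) 0 1; 0, η, 0; (Matrix.diagonal dg) 1 0, 0, (Matrix.diagonal dg) 1 1] : Matrix (Fin 3) (Fin 3) (w.1.adicCompletion L)) →
          (∀ i, Valued.v (dg i) = 1) →
          (∀ i, (galAdicCompletionMap (L := L) (IsCMField.complexConj L) hw) (dg i) = dg i) →
          (galAdicCompletionMap (L := L) (IsCMField.complexConj L) hw) η = η →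
          Valued.v η = 1 →
          (¬ ∃ t : (w.1.adicCompletion L), t * (galAdicCompletionMap (L := L) (IsCMField.complexConj L) hw) t = η) →
          γ₁ ∈ unitaryGroupOfForm (galAdicCompletionMap (L := L) (IsCMField.complexConj L) hw) (Matrix.diagonal dg) →
          (∀ i j, Valued.v ((γ₁ : Matrix (Fin 2) (Fin 2) (w.1.adicCompletion L)) i j) ≤ 1) →
          (γ₁ : Matrix (Fin 2) (Fin 2) (w.1.adicCompletion L)).charpoly = (((γH.1.val : GL (Fin 2) (UnitaryGroup.LocalRing L v)).val.map (Pi.evalRingHom (fun w' : UnitaryGroup.PlacesOver L v => w'.1.adicCompletion L) w))).charpoly →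
          ∀ (m : ℕ) (β : (v.adicCompletion ↥(maximalRealSubfield L))ˣ), Valued.v (((finCharpolyTwo L v γH).eval (finGammaTwo L v γH)) w) = Valued.v ((toPlace v w (HeckeCharacter.uniformizer ↥(maximalRealSubfield L) v : v.adicCompletion ↥(maximalRealSubfield L))) ^ m) →
            toPlace v w (β : (v.adicCompletion ↥(maximalRealSubfield L))) = -(((finCharpolyTwo L v γH).eval (finGammaTwo L v γH)) w * (finGammaTwo L v γH w ^ 2 + ((γH.1.val.val : Matrix (Fin 2) (Fin 2) (UnitaryGroup.LocalRing L v)).map (Pi.evalRingHom (fun w' : UnitaryGroup.PlacesOver L v => w'.1.adicCompletion L) w)).det)) / (2 * finGammaTwo L v γH w ^ 2 * ((γH.1.val.val : Matrix (Fin 2) (Fin 2) (UnitaryGroup.LocalRing L v)).map (Pi.evalRingHom (fun w' : UnitaryGroup.PlacesOver L v => w'.1.adicCompletion L) w)).det) →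
            (((Fintype.card (Valued.ResidueField (w.1.adicCompletion L))) : ℤ) - 1) * ((({M : Submodule (Valued.integer (w.1.adicCompletion L)) (Fin 3 → (w.1.adicCompletion L)) | IsVertexLattice (galAdicCompletionMap (L := L) (IsCMField.complexConj L) hw) ϖ ((StdForm.antidiagonal 3).over (w.1.adicCompletion L)) 0 M ∧ mapGL ((localNonsplitEquiv (IsCMField.complexConj L) (Matrix.of fun i j : Fin 3 => if i.val + j.val + 1 = 3 then (1 : L) else 0) (IsCMField.complexConj_ne_one L) w hw th : ↥(unitaryGroupOfForm (galAdicCompletionMap (L := L) (IsCMField.complexConj L) hw) (placeForm (Matrix.of fun i j : Fin 3 => if i.val + j.val + 1 = 3 then (1 : L) else 0) w.1))) : GL (Fin 3) (w.1.adicCompletion L)) M = M}.ncard : ℕ) : ℤ) - (({M : Submodule (Valued.integer (w.1.adicCompletion L)) (Fin 3 → (w.1.adicCompletion L)) | IsVertexLattice (galAdicCompletionMap (L := L) (IsCMField.complexConj L) hw) ϖ ((StdForm.antidiagonal 3).over (w.1.adicCompletion L)) 0 M ∧ mapGL ((localNonsplitEquiv (IsCMField.complexConj L) (Matrix.of fun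 i j : Fin 3 => if i.val + j.val + 1 = 3 then (1 : L) else 0) (IsCMField.complexConj_ne_one L) w hw ta : ↥(unitaryGroupOfForm (galAdicCompletionMap (L := L) (IsCMField.complexConj L) hw) (placeForm (Matrix.of fun i j : Fin 3 => if i.val + j.val + 1 = 3 then (1 : L) else 0) w.1))) : GL (Fin 3) (w.1.adicCompletion L)) M = M}.ncard : ℕ) : ℤ)) = (Literature.NumberTheory.QuadraticForms.hilbertSymbol (v.adicCompletion ↥(maximalRealSubfield L)) (β : (v.adicCompletion ↥(maximalRealSubfield L))) (algebraMap ↥(maximalRealSubfield L) _ ((cmQuadraticGenerator L : 𝓞 ↥(maximalRealSubfield L)) : ↥(maximalRealSubfield L))) : ℤ) * ((Fintype.card (Valued.ResidueField (w.1.adicCompletion L))) : ℤ) ^ m * ((((Fintype.card (Valued.ResidueField (w.1.adicCompletion L))) : ℤ) - 1) * (((Nat.card (MulAction.fixedBy (((UnitaryGroup.cmDatum L 2 (Matrix.of fun i j : Fin 2 => if i.val + j.val + 1 = 2 then (1 : L) else 0)).Local v) ⧸ cmLocalIntegralLevel L 2 (Matrix.of fun i j : Fin 2 => if i.val + j.val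 + 1 = 2 then (1 : L) else 0) v) γH.1)) + d % 2 : ℕ) : ℤ) - 2 * (((Fintype.card (Valued.ResidueField (w.1.adicCompletion L))) : ℤ) ^ (d - d % 2) - 1))) :
    (Nat.card (𝓞 ↥(maximalRealSubfield L) ⧸ v.asIdeal)) = (Fintype.card (Valued.ResidueField (w.1.adicCompletion L))) ∧
    ∃ V ∈ 𝓝 (1 : ((UnitaryGroup.cmDatum L 2 (Matrix.of fun i j : Fin 2 => if i.val + j.val + 1 = 2 then (1 : L) else 0)).Local v × (UnitaryGroup.cmDatum L 1 (Matrix.of fun i j : Fin 1 => if i.val + j.val + 1 = 1 then (1 : L) else 0)).Local v)), ∀ γH ∈ V, IsLocalGRegular L v γH →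
    ¬ (∃ x : (w.1.adicCompletion L), (((((γH).1.val : GL (Fin 2) (UnitaryGroup.LocalRing L v)).val.map (Pi.evalRingHom (fun w' : UnitaryGroup.PlacesOver L v => w'.1.adicCompletion L) w))).charpoly).IsRoot x) →
    ∃ (th ta : ((UnitaryGroup.cmDatum L 3 (Matrix.of fun i j : Fin 3 => if i.val + j.val + 1 = 3 then (1 : L) else 0)).Local v)) (sy et : ℤ) (mm NV : ℕ),
      IsLocalNormPair L (Matrix.of fun i j : Fin 3 => if i.val + j.val + 1 = 3 then (1 : L) else 0) v γH th ∧ IsLocalNormPair L (Matrix.of fun i j : Fin 3 => if i.val + j.val + 1 = 3 then (1 : L) else 0) v γH ta ∧ finKappaAt L v (Matrix.of fun i j : Fin 3 => if i.val + j.val + 1 = 3 then (1 : L) else 0) γH th = sy ∧ finKappaAt L v (Matrix.of fun i j : Fin 3 => if i.val + j.val + 1 = 3 then (1 : L) else 0) γH ta = -sy ∧ (sy = 1 ∨ sy = -1) ∧ (et = 1 ∨ et = -1) ∧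
      (((Fintype.card (Valued.ResidueField (w.1.adicCompletion L))) : ℤ) - 1) * ((({M : Submodule (Valued.integer (w.1.adicCompletion L)) (Fin 3 → (w.1.adicCompletion L)) | IsVertexLattice (galAdicCompletionMap (L := L) (IsCMField.complexConj L) hw) ϖ ((StdForm.antidiagonal 3).over (w.1.adicCompletion L)) 0 M ∧ mapGL ((localNonsplitEquiv (IsCMField.complexConj L) (Matrix.of fun i j : Fin 3 => if i.val + j.val + 1 = 3 then (1 : L) else 0) (IsCMField.complexConj_ne_one L) w hw th : ↥(unitaryGroupOfForm (galAdicCompletionMap (L := L) (IsCMField.complexConj L) hw) (placeForm (Matrix.of fun i j : Fin 3 => if i.val + j.val + 1 = 3 then (1 : L) else 0) w.1))) : GL (Fin 3) (w.1.adicCompletion L)) M = M}.ncard : ℕ) : ℤ) - (({M : Submodule (Valued.integer (w.1.adicCompletion L)) (Fin 3 → (w.1.adicCompletion L)) | IsVertexLattice (galAdicCompletionMap (L := L) (IsCMField.complexConj L) hw) ϖ ((StdForm.antidiagonal 3).over (w.1.adicCompletion L)) 0 M ∧ mapGL ((localNonsplitEquiv (IsCMField.complexConj L) (Matrix.of fun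 i j : Fin 3 => if i.val + j.val + 1 = 3 then (1 : L) else 0) (IsCMField.complexConj_ne_one L) w hw ta : ↥(unitaryGroupOfForm (galAdicCompletionMap (L := L) (IsCMField.complexConj L) hw) (placeForm (Matrix.of fun i j : Fin 3 => if i.val + j.val + 1 = 3 then (1 : L) else 0) w.1))) : GL (Fin 3) (w.1.adicCompletion L)) M = M}.ncard : ℕ) : ℤ)) = et * ((Fintype.card (Valued.ResidueField (w.1.adicCompletion L))) : ℤ) ^ mm * ((((Fintype.card (Valued.ResidueField (w.1.adicCompletion L))) : ℤ) - 1) * (NV : ℤ) - 2 * (((Fintype.card (Valued.ResidueField (w.1.adicCompletion L))) : ℤ) ^ (d - d % 2) - 1)) ∧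
      (Nat.card (MulAction.fixedBy (((UnitaryGroup.cmDatum L 2 (Matrix.of fun i j : Fin 2 => if i.val + j.val + 1 = 2 then (1 : L) else 0)).Local v) ⧸ cmLocalIntegralLevel L 2 (Matrix.of fun i j : Fin 2 => if i.val + j.val + 1 = 2 then (1 : L) else 0) v) γH.1)) + d % 2 = NV ∧
      (∀ (m : ℕ) (β : (v.adicCompletion ↥(maximalRealSubfield L))ˣ), Valued.v (((finCharpolyTwo L v γH).eval (finGammaTwo L v γH)) w) = Valued.v ((toPlace v w (HeckeCharacter.uniformizer ↥(maximalRealSubfield L) v : v.adicCompletion ↥(maximalRealSubfield L))) ^ m) →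
        toPlace v w (β : v.adicCompletion ↥(maximalRealSubfield L)) = -(((finCharpolyTwo L v γH).eval (finGammaTwo L v γH)) w * (finGammaTwo L v γH w ^ 2 + ((γH.1.val.val : Matrix (Fin 2) (Fin 2) (UnitaryGroup.LocalRing L v)).map (Pi.evalRingHom (fun w' : UnitaryGroup.PlacesOver L v => w'.1.adicCompletion L) w)).det)) / (2 * finGammaTwo L v γH w ^ 2 * ((γH.1.val.val : Matrix (Fin 2) (Fin 2) (UnitaryGroup.LocalRing L v)).map (Pi.evalRingHom (fun w' : UnitaryGroup.PlacesOver L v => w'.1.adicCompletion L) w)).det) →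
        m = mm ∧ (Literature.NumberTheory.QuadraticForms.hilbertSymbol (v.adicCompletion ↥(maximalRealSubfield L)) (β : v.adicCompletion ↥(maximalRealSubfield L)) (algebraMap ↥(maximalRealSubfield L) _ ((cmQuadraticGenerator L : 𝓞 ↥(maximalRealSubfield L)) : ↥(maximalRealSubfield L))) : ℂ) * (sy : ℂ) = (et : ℂ)) := by
  classical
  refine ⟨F0P3cDyRamFixedPointCensusTypeTwoPrelude.natCard_quot_eq_card_residueField L w hw he, ?_⟩
  -- the three neighbourhoods: tokens (★), anisotropic literal (socket), census (socket)
  obtain ⟨Vt, hVt, htok⟩ := tokens_anyPlace_of_isLocalGRegular L v w hw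
  obtain ⟨VA, hVA, hA⟩ := hLitA
  obtain ⟨VC, hVC, hC⟩ := hCensus
  refine ⟨Vt ∩ (VA ∩ VC), Filter.inter_mem hVt (Filter.inter_mem hVA hVC), fun γH hγ hreg hirr => ?_⟩
  obtain ⟨hγt, hγA, hγC⟩ := hγ
  -- THE TOKENS of `γ_H` (exist near 1 by ★; unique by ★ Prelude ∕ injectivity of `ι_w`)
  obtain ⟨⟨m₀, hm₀⟩, β₀, hβ₀⟩ := htok γH hγt hreg
  -- THE HYPERBOLIC LITERAL `t_h` (★ frame literal in `Φ₃`'s own frame `A := 1`; `κ = (1, θ)_v = 1`)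
  have hu : IsUnit ((finCharpolyTwo L v γH).eval (finGammaTwo L v γH)) := isUnit_eval_finCharpolyTwo_of_isLocalGRegular L v γH hreg
  have hH'w : IsUnit (placeForm (Matrix.of fun i j : Fin 3 => if i.val + j.val + 1 = 3 then (1 : L) else 0) w.1) := isUnit_placeForm_antidiagOne (E := L) 3 w.1
  have hdet : (placeForm (Matrix.of fun i j : Fin 3 => if i.val + j.val + 1 = 3 then (1 : L) else 0) w.1).det = -1 := by
    rw [placeForm_antidiagOne, F0P3cDyRamFixedPointCensusTypeTwoPrelude.antidiagonal_three_over_eq_block_antidiagonal_two, Matrix.det_fin_three]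
    simp [StdForm.over, StdForm.antidiagonal_J_apply, Fin.rev]
  have hframe : placeForm (Matrix.of fun i j : Fin 3 => if i.val + j.val + 1 = 3 then (1 : L) else 0) w.1 = (-(placeForm (Matrix.of fun i j : Fin 3 => if i.val + j.val + 1 = 3 then (1 : L) else 0) w.1).det) •
      formCongr (galAdicCompletionMap (L := L) (IsCMField.complexConj L) hw) (1 : GL (Fin 3) (w.1.adicCompletion L)) ((StdForm.antidiagonal 3).over (w.1.adicCompletion L)) := by
    rw [formCongr_one_eq, hdet, neg_neg, one_smul, placeForm_antidiagOne]
  have hyl : toPlace v w (1 : (v.adicCompletion ↥(maximalRealSubfield L))) = -(placeForm (Matrix.of fun i j : Fin 3 => if i.val + j.val + 1 = 3 then (1 : L) else 0) w.1).det := by rw [map_one, hdet, neg_neg]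
  obtain ⟨th, hth, hmat⟩ := exists_isLocalNormPair_coe_eq_of_frame L (Matrix.of fun i j : Fin 3 => if i.val + j.val + 1 = 3 then (1 : L) else 0) w hw hH'w 1 hframe γH
  have hκh : finKappaAt L v (Matrix.of fun i j : Fin 3 => if i.val + j.val + 1 = 3 then (1 : L) else 0) γH th = 1 := by
    rw [finKappaAt_eq_hilbertSymbol_of_coe_eq_of_frame L (Matrix.of fun i j : Fin 3 => if i.val + j.val + 1 = 3 then (1 : L) else 0) w hw hH'w 1 hframe 1 hyl γH hu hth hmat, hilbertSymbol_one_left]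
  rw [inv_one, one_mul, mul_one] at hmat
  -- THE ANISOTROPIC LITERAL `t_a` (socket `hLitA`)
  obtain ⟨ta, P₁, dg, η, γ₁, hta, hκa, hA1, hA2, hA3, hA4, hA7, hA8, hA9, hA10, hA11, hA12⟩ := hA γH hγA hreg hirr
  -- THE SIGNED CENSUS at the tokens `(m₀, β₀)` (socket `hCensus`)
  have hG := hC γH hγC hreg hirr th ta P₁ dg η γ₁ hmat hA1 hA2 hA3 hA4 hA7 hA8 hA9 hA10 hA11 hA12 m₀ β₀ hm₀ hβ₀
  refine ⟨th, ta, 1, Literature.NumberTheory.QuadraticForms.hilbertSymbol (v.adicCompletion ↥(maximalRealSubfield L)) (β₀ : (v.adicCompletion ↥(maximalRealSubfield L))) (algebraMap ↥(maximalRealSubfield L) _ ((cmQuadraticGenerator L : 𝓞 ↥(maximalRealSubfield L)) : ↥(maximalRealSubfield L))), m₀, (Nat.card (MulAction.fixedBy (((UnitaryGroup.cmDatum L 2 (Matrix.of fun i j : Fin 2 => if i.val + j.val + 1 = 2 then (1 : L) else 0)).Local v) ⧸ cmLocalIntegralLevel L 2 (Matrix.of fun i j : Fin 2 => if i.val + j.val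 + 1 = 2 then (1 : L) else 0) v) γH.1)) + d % 2, hth, hta, hκh, hκa, Or.inl rfl, hilbertSymbol_eq_one_or_eq_neg_one _ _, hG, rfl, fun m β hm hβ => ⟨?_, ?_⟩⟩
  · exact F0P3cDyRamFixedPointCensusTypeTwoPrelude.eq_of_valued_eq_toPlace_uniformizer_pow L w hw he hm hm₀
  · have hββ : (β : (v.adicCompletion ↥(maximalRealSubfield L))) = (β₀ : (v.adicCompletion ↥(maximalRealSubfield L))) := (toPlace v w).injective (hβ.trans hβ₀.symm)
    rw [hββ, Int.cast_one, mul_one]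

end Summit.HodgeConjecture.HodgeConjecture.Cruxes.H413.F0P3cDyRamFixedPointCensusTypeTwoOfOrgans

end
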